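import Mathlib.RingTheory.Nilpotent.Exp
import Mathlib.Tactic.Module
import Literature.LinearAlgebra.Matrix.NilpotentExpInjective
import HarnessLib

/-!
# EisensteinMonodromy — compression by a split idempotent, `exp`, and the key lemma

Pure matrix algebra for the proof of the support item
`Summit.Langlands.Langlands.Theses.EisensteinMonodromy.EnvelopeToTarget` (stmt-Langlands-2375).
Setting: `I : Matrix ι κ E`, `P : Matrix κ ι E` with `P * I = 1`, so `e := I * P` is an idempotent
and `X ↦ P * X * I` is multiplicative on the commutant of `e`.

* §1 the compression calculus (products, powers, nilpotency on the commutant of `e`);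
* §2 the rectangular intertwining rule `exp X * R = R * exp Y` (`X * R = R * Y`), hence
  `P * exp X * I = exp (P * X * I)`;
* §3 the KEY LEMMA `comm_of_comm_exp_smul`: an idempotent commuting with `exp (c • N)`
  (`N` nilpotent, `c ≠ 0`) commutes with `N` — via the involution `g = 1 - 2e`, the conjugation
  rule for `exp` and injectivity of `exp` on nilpotent matrices
  (`Literature.LinearAlgebra.Matrix.eq_of_exp_eq_exp`).

No named facts are assumed. [folklore]
-/

set_option linter.dupNamespace false

noncomputable section

namespace Summit.Langlands.Langlands.Theorems.EisensteinMonodromyEnvelopeCompression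

/-! ### §1 Compression by a split idempotent -/

section Compression

variable {E : Type*} [CommRing E] {ι κ : Type*} [Fintype ι] [Fintype κ] [DecidableEq ι]
  [DecidableEq κ] {I : Matrix ι κ E} {P : Matrix κ ι E}

omit [DecidableEq ι] in
/-- If `X` commutes with `e = I P` then `X I = I (P X I)`. [folklore] -/
theorem mul_eq_mul_compress (hPI : P * I = 1) {X : Matrix ι ι E}
    (hX : I * P * X = X * (I * P)) : X * I = I * (P * X * I) := by
  calc X * I = X * I * (P * I) := by rw [hPI, Matrix.mul_one]
    _ = X * (I * P) * I := by simp only [Matrix.mul_assoc]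
    _ = I * P * X * I := by rw [← hX]
    _ = I * (P * X * I) := by simp only [Matrix.mul_assoc]

omit [DecidableEq ι] in
/-- If `X` commutes with `e = I P` then `P X = (P X I) P`. [folklore] -/
theorem mul_eq_compress_mul (hPI : P * I = 1) {X : Matrix ι ι E}
    (hX : I * P * X = X * (I * P)) : P * X = P * X * I * P := by
  calc P * X = P * I * (P * X) := by rw [hPI, Matrix.one_mul]
    _ = P * (I * P * X) := by simp only [Matrix.mul_assoc]
    _ = P * (X * (I * P)) := by rw [hX]
    _ = P * X * I * P := by simp only [Matrix.mul_assoc]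

omit [DecidableEq ι] in
/-- Compression is multiplicative on the commutant of `e = I P` (only the right factor needs to
commute). [folklore] -/
theorem compress_mul (hPI : P * I = 1) (X : Matrix ι ι E) {Y : Matrix ι ι E}
    (hY : I * P * Y = Y * (I * P)) : P * (X * Y) * I = P * X * I * (P * Y * I) := by
  symm
  calc P * X * I * (P * Y * I) = P * X * (I * (P * Y * I)) := by simp only [Matrix.mul_assoc]
    _ = P * X * (Y * I) := by rw [← mul_eq_mul_compress hPI hY]
    _ = P * (X * Y) * I := by simp only [Matrix.mul_assoc]

/-- Compression of powers. [folklore] -/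
theorem compress_pow (hPI : P * I = 1) {X : Matrix ι ι E} (hX : I * P * X = X * (I * P))
    (k : ℕ) : P * X ^ k * I = (P * X * I) ^ k := by
  induction k with
  | zero => rw [pow_zero, pow_zero, Matrix.mul_one, hPI]
  | succ k ih => rw [pow_succ, pow_succ, compress_mul hPI _ hX, ih]

/-- Compression of a nilpotent in the commutant of `e` is nilpotent. [folklore] -/
theorem isNilpotent_compress (hPI : P * I = 1) {X : Matrix ι ι E}
    (hX : I * P * X = X * (I * P)) (hN : IsNilpotent X) : IsNilpotent (P * X * I) := by
  obtain ⟨k, hk⟩ := hN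
  exact ⟨k, by rw [← compress_pow hPI hX, hk, Matrix.mul_zero, Matrix.zero_mul]⟩

omit [DecidableEq ι] in
/-- `e = I P` is idempotent. [folklore] -/
theorem idem (hPI : P * I = 1) : I * P * (I * P) = I * P := by
  calc I * P * (I * P) = I * (P * I) * P := by simp only [Matrix.mul_assoc]
    _ = I * P := by rw [hPI, Matrix.mul_one]

omit [DecidableEq ι] in
/-- `P (R) I = ρ'` when `R I = I ρ'`. [folklore] -/
theorem compress_eq_of_mul_eq (hPI : P * I = 1) {X : Matrix ι ι E} {X' : Matrix κ κ E}
    (h : X * I = I * X') : P * X * I = X' := by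
  rw [Matrix.mul_assoc, h, ← Matrix.mul_assoc, hPI, Matrix.one_mul]

omit [DecidableEq ι] [DecidableEq κ] in
/-- `e` commutes with `X` when `X I = I X'` and `P X = X' P`. [folklore] -/
theorem comm_of_intertwine {X : Matrix ι ι E} {X' : Matrix κ κ E} (hI : X * I = I * X')
    (hP : P * X = X' * P) : I * P * X = X * (I * P) := by
  rw [Matrix.mul_assoc, hP, ← Matrix.mul_assoc, ← hI, Matrix.mul_assoc]

/-- Rectangular intertwining of powers. [folklore] -/
theorem pow_mul_eq_mul_pow_rect {X : Matrix ι ι E} {Y : Matrix κ κ E} {R : Matrix ι κ E}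
    (h : X * R = R * Y) (i : ℕ) : X ^ i * R = R * Y ^ i := by
  induction i with
  | zero => rw [pow_zero, pow_zero, Matrix.one_mul, Matrix.mul_one]
  | succ i ih => rw [pow_succ, Matrix.mul_assoc, h, ← Matrix.mul_assoc, ih, Matrix.mul_assoc,
      ← pow_succ]

end Compression

/-! ### §2 `exp` and compression -/

section Exp

variable {E : Type*} [Field E] [CharZero E] {ι κ : Type*} [Fintype ι] [Fintype κ] [DecidableEq ι]
  [DecidableEq κ] {I : Matrix ι κ E} {P : Matrix κ ι E}

/-- **Rectangular intertwining rule for `exp`**: `X R = R Y` with `X, Y` nilpotent gives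
`exp X · R = R · exp Y` (termwise). [folklore] -/
theorem exp_mul_eq_mul_exp_rect {X : Matrix ι ι E} {Y : Matrix κ κ E} {R : Matrix ι κ E}
    (hX : IsNilpotent X) (hY : IsNilpotent Y) (h : X * R = R * Y) :
    IsNilpotent.exp X * R = R * IsNilpotent.exp Y := by
  obtain ⟨a, ha⟩ := hX
  obtain ⟨b, hb⟩ := hY
  have haM : X ^ (a + b) = 0 := pow_eq_zero_of_le (by omega) ha
  have hbM : Y ^ (a + b) = 0 := pow_eq_zero_of_le (by omega) hb
  rw [IsNilpotent.exp_eq_sum haM, IsNilpotent.exp_eq_sum hbM, Matrix.sum_mul, Matrix.mul_sum]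
  refine Finset.sum_congr rfl fun i _ => ?_
  rw [Matrix.smul_mul, Matrix.mul_smul, pow_mul_eq_mul_pow_rect h]

/-- `exp` commutes with compression on the commutant of `e`: `P exp(X) I = exp (P X I)`.
[folklore] -/
theorem compress_exp (hPI : P * I = 1) {X : Matrix ι ι E} (hX : I * P * X = X * (I * P))
    (hN : IsNilpotent X) : P * IsNilpotent.exp X * I = IsNilpotent.exp (P * X * I) := by
  have h1 := exp_mul_eq_mul_exp_rect hN (isNilpotent_compress hPI hX hN)
    (mul_eq_mul_compress hPI hX)
  rw [Matrix.mul_assoc, h1, ← Matrix.mul_assoc, hPI, Matrix.one_mul]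

/-- `exp X` lies in the commutant of `e` when `X` does. [folklore] -/
theorem comm_exp (e : Matrix ι ι E) {X : Matrix ι ι E} (hX : e * X = X * e)
    (hN : IsNilpotent X) : e * IsNilpotent.exp X = IsNilpotent.exp X * e :=
  (Literature.LinearAlgebra.Matrix.exp_mul_eq_mul_exp hN hN hX.symm).symm

omit [CharZero E] [DecidableEq ι] in
/-- Scalar multiples and negatives stay in the commutant. [folklore] -/
theorem comm_neg_smul (e : Matrix ι ι E) {X : Matrix ι ι E} (hX : e * X = X * e) (a : E) :
    e * (-(a • X)) = -(a • X) * e := by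
  rw [Matrix.mul_neg, Matrix.neg_mul, Matrix.mul_smul, Matrix.smul_mul, hX]

/-! ### §3 The key lemma: an idempotent commuting with `exp (c • N)` commutes with `N` -/

/-- **Key lemma.** If `e` is idempotent, `N` nilpotent, `c ≠ 0` and `e` commutes with
`exp (c • N)`, then `e` commutes with `N`.  Proof: `g = 1 - 2e` is an involution commuting with
`exp (cN)`, so `exp (cN) = g exp(cN) g = exp (g (cN) g)` (conjugation rule), hence
`g (cN) g = cN` by injectivity of `exp` on nilpotents, i.e. `g` — and therefore `e` — commutes
with `N`. [folklore] -/
theorem comm_of_comm_exp_smul {e N : Matrix ι ι E} (he : e * e = e) (hN : IsNilpotent N)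
    {c : E} (hc : c ≠ 0)
    (h : e * IsNilpotent.exp (c • N) = IsNilpotent.exp (c • N) * e) : e * N = N * e := by
  set g : Matrix ι ι E := 1 - (2 : E) • e with hg
  have h22 : ((2 : E) * 2) • e = (2 : E) • e + (2 : E) • e := by rw [← add_smul]; norm_num
  have hgg : g * g = 1 := by
    simp only [hg, sub_mul, mul_sub, Matrix.one_mul, Matrix.mul_one, Matrix.smul_mul,
      Matrix.mul_smul, he, smul_smul, h22]
    abel
  have hge : ∀ X : Matrix ι ι E, e * X = X * e → g * X = X * g := by
    intro X hX
    simp only [hg, sub_mul, mul_sub, Matrix.one_mul, Matrix.mul_one, Matrix.smul_mul,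
      Matrix.mul_smul, hX]
  set X : Matrix ι ι E := c • N with hXdef
  have hXnil : IsNilpotent X := hN.smul c
  have hYpow : ∀ j : ℕ, (g * X * g) ^ j = g * X ^ j * g := by
    intro j
    induction j with
    | zero => rw [pow_zero, pow_zero, Matrix.mul_one, hgg]
    | succ j ih =>
      rw [pow_succ, ih, pow_succ]
      calc g * X ^ j * g * (g * X * g) = g * X ^ j * (g * g) * X * g := by
            simp only [Matrix.mul_assoc]
        _ = g * (X ^ j * X) * g := by rw [hgg, Matrix.mul_one]; simp only [Matrix.mul_assoc]
  have hYnil : IsNilpotent (g * X * g) := by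
    obtain ⟨k, hk⟩ := hXnil
    exact ⟨k, by rw [hYpow, hk, Matrix.mul_zero, Matrix.zero_mul]⟩
  have h1 : IsNilpotent.exp X * g = g * IsNilpotent.exp (g * X * g) :=
    Literature.LinearAlgebra.Matrix.exp_mul_eq_mul_exp hXnil hYnil
      (by rw [← Matrix.mul_assoc, ← Matrix.mul_assoc, hgg, Matrix.one_mul])
  have h2 : IsNilpotent.exp X * g = g * IsNilpotent.exp X := (hge _ h).symm
  have h3 : IsNilpotent.exp (g * X * g) = IsNilpotent.exp X := by
    have h4 := congrArg (g * ·) (h1.symm.trans h2)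
    simpa only [← Matrix.mul_assoc, hgg, Matrix.one_mul] using h4
  have h4 : g * X * g = X := Literature.LinearAlgebra.Matrix.eq_of_exp_eq_exp hYnil hXnil h3
  have h5 : g * X = X * g := by
    have h6 := congrArg (· * g) h4
    simpa only [Matrix.mul_assoc, hgg, Matrix.mul_one] using h6
  have h6 : g * N = N * g := by
    have h7 : c • (g * N) = c • (N * g) := by
      rw [← Matrix.mul_smul, ← Matrix.smul_mul]
      exact h5
    exact smul_right_injective (Matrix ι ι E) hc h7
  have h7 : e * N - N * e = 0 := by
    have h8 : (2 : E) • (e * N - N * e) = 0 := by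
      calc (2 : E) • (e * N - N * e) = -(g * N - N * g) := by
            simp only [hg, sub_mul, mul_sub, Matrix.one_mul, Matrix.mul_one, Matrix.smul_mul,
              Matrix.mul_smul, smul_sub]
            abel
        _ = 0 := by rw [sub_eq_zero.mpr h6, neg_zero]
    exact (smul_eq_zero.mp h8).resolve_left two_ne_zero
  exact sub_eq_zero.mp h7

end Exp

end Summit.Langlands.Langlands.Theorems.EisensteinMonodromyEnvelopeCompression

end
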